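import Summits.QuantumFields.YangMills.Theorems.BalabanUVNodesN10OlderTermsBanachSection
import Literature.MathematicalPhysics.QuantumFieldTheory.Balaban1983to89.B13OlderTermsTableGerms

/-!
# BalabanUVNodes ∕ N10 ([B13], NODE A) → N22 (NE9): module 104's Banach-section letters AT THE CARRIER OF BOUNDED ANALYTIC TABLE GERMS (module 105) — the three
# reading axioms (R1)∕(R2)∕(R3) DISCHARGED, so module 102 §3's `hcv` and module 37's `hVd`∕`hVm`∕`h220W` along the section rest on def-W1's laws and history-free
# Wilson data only; and the reading-side rows (AR-adm)∕(AR-dom₁)∕(AR-dom₂) of N22's binder for this reading (module 106)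

Track A of `YM-PLAN.md` (cell `pub-ymgap`, HUMAN RULING D-0062), seat `pub-ymgap-dag-n10-c` g19, DAG edge **N10 → N22**, module 106 (sequel of module 104
`…N10OlderTermsBanachSection` and the Literature carrier `B13OlderTermsTableGerms`, module 105).  THEOREMS ONLY (0 `def`, 0 `sorry`, standard axioms);
`--supports stmt-QuantumFields-27364 --as helper`; COUNT-NEUTRAL.  Interface row IR-N22-AR, producer side, file 5.

WHAT.  At `Pot := B13OlderTermsTableGerms.Pot k sp` (bounded tables with table-analytic germs, weighted sup norm), `cv := cv κ bw`, `ρ := ρ sp κ bw` (positive level weights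
`b ≤ bw j ≤ Bw`, `0 ≤ κ ≤ r₁`, open tables):
* §1 ★★★ `𝒱_tableGerms_reading` (102 §3's `hcv` for EVERY admissible history, from the laws alone), ★★★ `differentiableOn_𝒱_tableGerms` (`hVd`), ★★★ `measurable_𝒱_tableGerms` (`hVm`),
  ★★ `sum_norm_𝒱_tableGerms_le` (`h220W`) — module 104 §2 with (R1)∕(R2)∕(R3) supplied by module 105 (`cv_ρ_eqOn_of_admHist`, `cv_add`, `cv_smul`, `norm_cv_le`, `analyticOnNhd_cv`).
* §3 ★★ `sum_norm_𝒱_section_le_of_record220` (ANY section) ∕ ★★ `sum_norm_𝒱_tableGerms_le_of_record220` — `h220W` along the section FROM THE RECORD's (2.20) AT ONE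
  ADMISSIBLE HISTORY `old₀` (this lane's located input `h220U`): `𝐕(cv p) − 𝐕(old₀) = 𝒪(cv p) − 𝒪(old₀)` and both older parts have storey 17's crude size, so
  `w := w₀ + τ_Σ·(Σ_j Σ_X C)·m·(E₀ + C_v R_p)` — module 37's three history letters along the section now rest on the RECORD + def-W1's laws only.
* §2 the reading-side rows of N22's (AR) binder for THIS reading, re-exported Summit-side: `norm_ρ_le_of_admHist` ((AR-adm)), `norm_ρ_sub_ρ_le_succ` ((AR-dom₁)),
  `norm_ρ_threePoint_le_succ` ((AR-dom₂)) — one `exact` each (recorded here so the consumer finds the whole block in one Summits file).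
HONEST FRAMING (binding).  Kernel composition; def-W1's laws (storeys 11∕17), the atoms' laws and the history-free Wilson data are DISPLAYED; nothing of Bałaban's asserted;
N10 ∕ N22 NOT discharged; counts UNMOVED (5∕27); nothing continuum ∕ ℝ⁴ ∕ OS ∕ mass-gap ∕ Clay.
-/

noncomputable section

open Set Metric MeasureTheory
open scoped BigOperators Matrix

namespace YMDAG.N10

open Literature.MathematicalPhysics.QuantumFieldTheory.Balaban1983to89
open Literature.MathematicalPhysics.QuantumFieldTheory.Balaban1983to89.TreeLengthTorus (TDom)
open Literature.MathematicalPhysics.QuantumFieldTheory.Balaban1983to89.Node00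
open Literature.MathematicalPhysics.QuantumFieldTheory.Balaban1983to89.Node00.Sect2 (domSys domCount CPair)
open Literature.MathematicalPhysics.QuantumFieldTheory.Balaban1983to89.Node00.W1
open Literature.MathematicalPhysics.QuantumFieldTheory.Balaban1983to89.B13OlderTermsTableGerms (Pot cv ρ cv_add cv_smul norm_cv_le analyticOnNhd_cv
  cv_ρ_eqOn_of_admHist)

variable {c₀ : B13.Consts} {P : Params} {𝔸 : Type} [NormedRing 𝔸] [NormedAlgebra ℂ 𝔸] {M k L : ℕ} [NeZero L]
  (𝔇 : TermDatum214 c₀ P 𝔸 M k L) {S : Type} [MeasurableSpace S] [TopologicalSpace S] [OpensMeasurableSpace S]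
  (sp : (j : ℕ) → (domSys P M j).Dom → Set (CPair P 𝔸)) (κ : ℝ) (bw : Fin (k + 1) → ℝ)
  {χu χcu : 𝔇.UnscaledChi} {𝒲 : 𝔇.UnscaledWilson} {𝒪 : 𝔇.UnscaledOlder} {γ : ℝ}
  (R : (Z : (domSys P M (k + 1)).Dom) → (t : TermLabel P M k L) → 𝔇.ReadingAtoms Z t S)
  (W : (Z : (domSys P M (k + 1)).Dom) → TermLabel P M k L → Set (CPair P 𝔸)) {C m b Bw E₀ r₁ : ℝ}

/-! ## §1 Module 104 §2 at the table-germ carrier: the reading axioms discharged -/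

omit [TopologicalSpace S] [OpensMeasurableSpace S] in
/-- ★★★ **102 §3's `hcv` AT THE TABLE-GERM READING, EVERY ADMISSIBLE HISTORY**: under the two laws with the atoms staying in the tables, for `old ∈ W1.AdmHist sp E₀ r₁ k`
(`κ ≤ r₁`, positive level weights, open tables): `𝔇.𝒱 Z t s (cv (ρ old)) φ Y B = 𝔇.𝒱 Z t s old φ Y B` at every window coupling — (R1) by `cv_ρ_eqOn_of_admHist`. [folklore] -/
theorem 𝒱_tableGerms_reading (hlaw : 𝔇.UnscaledFieldLawOn χu χcu 𝒲 𝒪 γ) (hread : 𝔇.ReadsBy 𝒪 R)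
    (hmaps : ∀ Z t, (R Z t).MapsToTables sp (W Z t) univ) (hsp : ∀ (j : ℕ) (Y : (domSys P M j).Dom), IsOpen (sp j Y))
    (hκ : κ ≤ r₁) (hE₀ : 0 ≤ E₀) (hbwpos : ∀ j, 0 < bw j) (hbw : ∀ j, bw j ≤ Bw)
    {Z : (domSys P M (k + 1)).Dom} {t : TermLabel P M k L} {s : ℝ} (hs : s ∈ Ioc (0 : ℝ) γ)
    {old : OlderTerms P 𝔸 M k} (hold : old ∈ AdmHist sp E₀ r₁ k) {φ : CPair P 𝔸} (hφ : φ ∈ W Z t)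
    (Y : TDom P.d (L * domCount P M (k + 1))) (B : (𝔇.𝒦 Z t).Λ → ℝ) :
    𝔇.𝒱 Z t ((s : ℝ) : ℂ) (cv κ bw (ρ sp κ bw old)) φ Y B = 𝔇.𝒱 Z t ((s : ℝ) : ℂ) old φ Y B :=
  𝒱_section_reading 𝔇 sp (cv (k := k) (sp := sp) κ bw) R W hlaw hread hmaps hs (cv_ρ_eqOn_of_admHist κ bw hsp hκ hE₀ hbwpos hbw hold) hφ Y B

/-- ★★★ **MODULE 37's `hVd` AT THE TABLE-GERM SECTION**: `p ↦ 𝔇.𝒱 Z t s (cv p) φ Y B` complex differentiable on ANY `U` (`0 ≤ κ`, level weights `b ≤ bw j`, `0 < b`). [folklore] -/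
theorem differentiableOn_𝒱_tableGerms (hlaw : 𝔇.UnscaledFieldLawOn χu χcu 𝒲 𝒪 γ) (hread : 𝔇.ReadsBy 𝒪 R)
    (hmaps : ∀ Z t, (R Z t).MapsToTables sp (W Z t) univ) (hcont : ∀ Z t, (R Z t).CfgContinuous) (hK : ∀ Z t, (R Z t).KernelBounded C)
    (hμ : ∀ Z t, (R Z t).FiniteMass m) (hC : 0 ≤ C) (hm : 0 ≤ m) (hκ : 0 ≤ κ) (hb : 0 < b) (hbw : ∀ j, b ≤ bw j)
    {Z : (domSys P M (k + 1)).Dom} {t : TermLabel P M k L} {s : ℝ} (hs : s ∈ Ioc (0 : ℝ) γ) {φ : CPair P 𝔸} (hφ : φ ∈ W Z t)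
    (Y : TDom P.d (L * domCount P M (k + 1))) (B : (𝔇.𝒦 Z t).Λ → ℝ) (U : Set (Pot k sp)) :
    DifferentiableOn ℂ (fun p => 𝔇.𝒱 Z t ((s : ℝ) : ℂ) (cv κ bw p) φ Y B) U :=
  differentiableOn_𝒱_section 𝔇 sp (cv (k := k) (sp := sp) κ bw) R W hlaw hread hmaps hcont hK hμ hC hm (inv_pos.2 hb).le
    (fun p q j X ψ _ => cv_add κ bw p q j X ψ) (fun a p j X ψ _ => cv_smul κ bw a p j X ψ)
    (fun p j X ψ _ => norm_cv_le κ bw hκ hb hbw p j X ψ) (fun p j X => analyticOnNhd_cv κ bw p j X) hs hφ Y B U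

/-- ★★★ **MODULE 37's `hVm` AT THE TABLE-GERM SECTION** (from the Wilson part's measurability). [folklore] -/
theorem measurable_𝒱_tableGerms (hlaw : 𝔇.UnscaledFieldLawOn χu χcu 𝒲 𝒪 γ) (hread : 𝔇.ReadsBy 𝒪 R)
    (hmaps : ∀ Z t, (R Z t).MapsToTables sp (W Z t) univ) (hjc : ∀ Z t, (R Z t).CfgJointContinuous) (hK : ∀ Z t, (R Z t).KernelBounded C)
    (hμ : ∀ Z t, (R Z t).FiniteMass m) (hκ : 0 ≤ κ) (hb : 0 < b) (hbw : ∀ j, b ≤ bw j)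
    (hWm : ∀ (Z : (domSys P M (k + 1)).Dom) (t : TermLabel P M k L) (φ : CPair P 𝔸) (Y : TDom P.d (L * domCount P M (k + 1))),
      Measurable fun B : (𝔇.𝒦 Z t).Λ → ℝ => 𝒲 Z t φ Y B)
    {Z : (domSys P M (k + 1)).Dom} {t : TermLabel P M k L} {s : ℝ} (hs : s ∈ Ioc (0 : ℝ) γ) {φ : CPair P 𝔸} (hφ : φ ∈ W Z t) (p : Pot k sp)
    (Y : TDom P.d (L * domCount P M (k + 1))) :
    Measurable (𝔇.𝒱 Z t ((s : ℝ) : ℂ) (cv κ bw p) φ Y) :=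
  measurable_𝒱_section 𝔇 sp (cv (k := k) (sp := sp) κ bw) R W hlaw hread hmaps hjc hK hμ (fun p j X ψ _ => norm_cv_le κ bw hκ hb hbw p j X ψ)
    (fun p j X => analyticOnNhd_cv κ bw p j X) hWm hs hφ p Y

omit [TopologicalSpace S] [OpensMeasurableSpace S] in
/-- ★★ **MODULE 37's `h220W` AT THE TABLE-GERM SECTION** (from a history-free (2.20)-shape bound of the Wilson part on the τ-region and the region's size;
`w := w₁ + τ_Σ·(Σ_j Σ_X C)·b⁻¹·m·R_p`). [folklore] -/
theorem sum_norm_𝒱_tableGerms_le (hlaw : 𝔇.UnscaledFieldLawOn χu χcu 𝒲 𝒪 γ) (hread : 𝔇.ReadsBy 𝒪 R)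
    (hmaps : ∀ Z t, (R Z t).MapsToTables sp (W Z t) univ) (hK : ∀ Z t, (R Z t).KernelBounded C) (hμ : ∀ Z t, (R Z t).FiniteMass m)
    (hC : 0 ≤ C) (hm : 0 ≤ m) (hκ : 0 ≤ κ) (hb : 0 < b) (hbw : ∀ j, b ≤ bw j)
    {Z : (domSys P M (k + 1)).Dom} {t : TermLabel P M k L} {s : ℝ} (hs : s ∈ Ioc (0 : ℝ) γ) {φ : CPair P 𝔸} (hφ : φ ∈ W Z t)
    {Uτ : TDom P.d (L * domCount P M (k + 1)) → Set ℂ} {τs a₂₀ w₁ Rp : ℝ} (hRp : 0 ≤ Rp)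
    (hτ : ∀ τ : TDom P.d (L * domCount P M (k + 1)) → ℂ, (∀ Y, τ Y ∈ Uτ Y) → ∑ Y ∈ t.1, ‖τ Y‖ ≤ τs)
    (hW220 : ∀ τ : TDom P.d (L * domCount P M (k + 1)) → ℂ, (∀ Y, τ Y ∈ Uτ Y) → ∀ B : (𝔇.𝒦 Z t).Λ → ℝ,
      ∑ Y ∈ t.1, ‖τ Y‖ * ‖(((s : ℝ) : ℂ) ^ 2)⁻¹ * 𝒲 Z t φ Y (s • B)‖ ≤ a₂₀ / 2 * (B ⬝ᵥ B) + w₁)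
    {p : Pot k sp} (hp : ‖p‖ ≤ Rp) (τ : TDom P.d (L * domCount P M (k + 1)) → ℂ) (hτU : ∀ Y, τ Y ∈ Uτ Y) (B : (𝔇.𝒦 Z t).Λ → ℝ) :
    ∑ Y ∈ t.1, ‖τ Y‖ * ‖𝔇.𝒱 Z t ((s : ℝ) : ℂ) (cv κ bw p) φ Y B‖ ≤
      a₂₀ / 2 * (B ⬝ᵥ B) + (w₁ + τs * ((∑ _j : Fin (k + 1), ∑ _X : (domSys P M _j).Dom, C) * b⁻¹ * m * Rp)) :=
  sum_norm_𝒱_section_le 𝔇 sp (cv (k := k) (sp := sp) κ bw) R W hlaw hread hmaps hK hμ hC hm (inv_pos.2 hb).le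
    (fun p j X ψ _ => norm_cv_le κ bw hκ hb hbw p j X ψ) (fun p j X => analyticOnNhd_cv κ bw p j X) hs hφ hRp hτ hW220 hp τ hτU B

/-! ## §3 `h220W` along a section FROM THE RECORD's (2.20) AT ONE ADMISSIBLE HISTORY (generic section, then the table-germ section) -/
section FromRecord220

variable {Pot' : Type*} [NormedAddCommGroup Pot'] (cv' : Pot' → OlderTerms P 𝔸 M k) {Cv : ℝ}

omit [TopologicalSpace S] [OpensMeasurableSpace S] in
/-- ★★ **MODULE 37's `h220W` ALONG ANY SECTION FROM THE RECORD's (2.20) AT ONE ADMISSIBLE HISTORY `old₀`.**  Under the two laws (atoms in the tables for the window, clamped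
reading): if (2.20) holds for the datum's potentials AT `old₀ ∈ W1.AdmHist sp E₀ r₁ k` on the τ-region (`Σ_Y ‖τ Y‖·‖𝐕_k(Y; s, old₀, φ; B)‖ ≤ ½a₂₀(B·B) + w₀` — the located input
`h220U` of this lane's `Inputs226Holo` record, [II] (2.20) p. 16 with Lemma 2 (1.43)), `0 ≤ r₁`, and the τ-region has `Σ_Y ‖τ Y‖ ≤ τ_Σ`, then along a section with (R2-bound)∕(R3)
(`‖cv p _j X ψ‖ ≤ C_v‖p‖`, analytic on the tables), for `‖p‖ ≤ R_p`:
**`Σ_Y ‖τ Y‖·‖𝐕_k(Y; s, cv p, φ; B)‖ ≤ ½a₂₀(B·B) + (w₀ + τ_Σ·(Σ_j Σ_X C)·m·(E₀ + C_v·R_p))`** — `𝐕(cv p) − 𝐕(old₀) = 𝒪(cv p) − 𝒪(old₀)` (the Wilson part is history-free)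
and both older parts have the crude size (storey 17 `norm_potential_le_of_sizeAdm`). [folklore] -/
theorem sum_norm_𝒱_section_le_of_record220 (hlaw : 𝔇.UnscaledFieldLawOn χu χcu 𝒲 𝒪 γ) (hread : 𝔇.ReadsBy 𝒪 R)
    (hmaps : ∀ Z t, (R Z t).MapsToTables sp (W Z t) univ) (hK : ∀ Z t, (R Z t).KernelBounded C) (hμ : ∀ Z t, (R Z t).FiniteMass m)
    (hC : 0 ≤ C) (hm : 0 ≤ m) (hCv0 : 0 ≤ Cv) (hE₀ : 0 ≤ E₀) (hr₁ : 0 ≤ r₁)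
    (hCv : ∀ (p : Pot') (j : Fin (k + 1)) (X : (domSys P M j).Dom), ∀ ψ ∈ sp j X, ‖cv' p j X ψ‖ ≤ Cv * ‖p‖)
    (han : ∀ (p : Pot') (j : Fin (k + 1)) (X : (domSys P M j).Dom), AnalyticOnNhd ℂ (cv' p j X) (sp j X))
    {Z : (domSys P M (k + 1)).Dom} {t : TermLabel P M k L} {s : ℝ} (hs : s ∈ Ioc (0 : ℝ) γ) {φ : CPair P 𝔸} (hφ : φ ∈ W Z t)
    {old₀ : OlderTerms P 𝔸 M k} (hold₀ : old₀ ∈ AdmHist sp E₀ r₁ k)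
    {Uτ : TDom P.d (L * domCount P M (k + 1)) → Set ℂ} {τs a₂₀ w₀ Rp : ℝ} (hRp : 0 ≤ Rp)
    (hτ : ∀ τ : TDom P.d (L * domCount P M (k + 1)) → ℂ, (∀ Y, τ Y ∈ Uτ Y) → ∑ Y ∈ t.1, ‖τ Y‖ ≤ τs)
    (h220₀ : ∀ τ : TDom P.d (L * domCount P M (k + 1)) → ℂ, (∀ Y, τ Y ∈ Uτ Y) → ∀ B : (𝔇.𝒦 Z t).Λ → ℝ,
      ∑ Y ∈ t.1, ‖τ Y‖ * ‖𝔇.𝒱 Z t ((s : ℝ) : ℂ) old₀ φ Y B‖ ≤ a₂₀ / 2 * (B ⬝ᵥ B) + w₀)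
    {p : Pot'} (hp : ‖p‖ ≤ Rp) (τ : TDom P.d (L * domCount P M (k + 1)) → ℂ) (hτU : ∀ Y, τ Y ∈ Uτ Y) (B : (𝔇.𝒦 Z t).Λ → ℝ) :
    ∑ Y ∈ t.1, ‖τ Y‖ * ‖𝔇.𝒱 Z t ((s : ℝ) : ℂ) (cv' p) φ Y B‖ ≤
      a₂₀ / 2 * (B ⬝ᵥ B) + (w₀ + τs * ((∑ _j : Fin (k + 1), ∑ _X : (domSys P M _j).Dom, C) * m * (E₀ + Cv * Rp))) := by
  obtain ⟨S₀, hS₀⟩ : ∃ S₀ : ℝ, S₀ = ∑ _j : Fin (k + 1), ∑ _X : (domSys P M _j).Dom, C := ⟨_, rfl⟩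
  have hS₀0 : 0 ≤ S₀ := by rw [hS₀]; exact Finset.sum_nonneg fun j _ => Finset.sum_nonneg fun X _ => hC
  rw [← hS₀]
  -- the older part at `old₀`: crude size `S₀·E₀·m` (rate dropped)
  have hO₀ : ∀ Y (A : (𝔇.𝒦 Z t).Λ → ℝ), ‖(R Z t).potential old₀ φ Y A‖ ≤ S₀ * m * E₀ := by
    intro Y A
    have h := (R Z t).norm_potential_le_of_sizeAdm hC hE₀ (hmaps Z t) (hK Z t) (hμ Z t) hold₀.1 hφ Y (mem_univ A)
    refine h.trans ?_
    have e : ∀ (j : Fin (k + 1)) (X : (domSys P M j).Dom), C * (E₀ * Real.exp (-(r₁ * (domSys P M j).dj X))) * m ≤ C * (E₀ * 1) * m := by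
      intro j X
      refine mul_le_mul_of_nonneg_right (mul_le_mul_of_nonneg_left ?_ hC) hm
      exact mul_le_mul_of_nonneg_left (Real.exp_le_one_iff.2 (by
        have := (domSys P M j).dj_nonneg X; nlinarith)) hE₀
    calc ∑ j : Fin (k + 1), ∑ X : (domSys P M j).Dom, C * (E₀ * Real.exp (-(r₁ * (domSys P M j).dj X))) * m
        ≤ ∑ j : Fin (k + 1), ∑ X : (domSys P M j).Dom, C * (E₀ * 1) * m := Finset.sum_le_sum fun j _ => Finset.sum_le_sum fun X _ => e j X
      _ = S₀ * m * E₀ := by rw [hS₀, Finset.sum_mul, Finset.sum_mul]; refine Finset.sum_congr rfl fun j _ => ?_; rw [Finset.sum_mul, Finset.sum_mul]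
                            ; exact Finset.sum_congr rfl fun X _ => by ring
  -- the older part along the section: crude size `S₀·C_v·m·‖p‖`
  have hOp : ∀ Y (A : (𝔇.𝒦 Z t).Λ → ℝ), ‖(R Z t).potential (cv' p) φ Y A‖ ≤ S₀ * Cv * m * Rp := fun Y A => by
    refine (norm_potential_section_le sp cv' (R Z t) (hmaps Z t) (hK Z t) (hμ Z t) hC hCv0 hCv han hφ p Y A).trans ?_
    rw [hS₀]
    exact mul_le_mul_of_nonneg_left hp (by positivity)
  -- per domain
  have hY : ∀ Y, ‖𝔇.𝒱 Z t ((s : ℝ) : ℂ) (cv' p) φ Y B‖ ≤ ‖𝔇.𝒱 Z t ((s : ℝ) : ℂ) old₀ φ Y B‖ + (S₀ * m * E₀ + S₀ * Cv * m * Rp) := by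
    intro Y
    have e1 := TermDatum214.UnscaledFieldLawOn.𝒱_eq 𝔇 hlaw Z t hs (cv' p) φ Y B
    have e0 := TermDatum214.UnscaledFieldLawOn.𝒱_eq 𝔇 hlaw Z t hs old₀ φ Y B
    rw [hread Z t] at e1 e0
    have e : 𝔇.𝒱 Z t ((s : ℝ) : ℂ) (cv' p) φ Y B =
        𝔇.𝒱 Z t ((s : ℝ) : ℂ) old₀ φ Y B - (R Z t).potential old₀ φ Y (s • B) + (R Z t).potential (cv' p) φ Y (s • B) := by
      rw [e1, e0]; ring
    rw [e]
    calc ‖𝔇.𝒱 Z t ((s : ℝ) : ℂ) old₀ φ Y B - (R Z t).potential old₀ φ Y (s • B) + (R Z t).potential (cv' p) φ Y (s • B)‖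
        ≤ ‖𝔇.𝒱 Z t ((s : ℝ) : ℂ) old₀ φ Y B - (R Z t).potential old₀ φ Y (s • B)‖ + ‖(R Z t).potential (cv' p) φ Y (s • B)‖ := norm_add_le _ _
      _ ≤ (‖𝔇.𝒱 Z t ((s : ℝ) : ℂ) old₀ φ Y B‖ + ‖(R Z t).potential old₀ φ Y (s • B)‖) + ‖(R Z t).potential (cv' p) φ Y (s • B)‖ :=
          add_le_add (norm_sub_le _ _) le_rfl
      _ ≤ (‖𝔇.𝒱 Z t ((s : ℝ) : ℂ) old₀ φ Y B‖ + S₀ * m * E₀) + S₀ * Cv * m * Rp := add_le_add (add_le_add le_rfl (hO₀ Y _)) (hOp Y _)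
      _ = _ := by ring
  calc ∑ Y ∈ t.1, ‖τ Y‖ * ‖𝔇.𝒱 Z t ((s : ℝ) : ℂ) (cv' p) φ Y B‖
      ≤ ∑ Y ∈ t.1, (‖τ Y‖ * ‖𝔇.𝒱 Z t ((s : ℝ) : ℂ) old₀ φ Y B‖ + ‖τ Y‖ * (S₀ * m * E₀ + S₀ * Cv * m * Rp)) :=
        Finset.sum_le_sum fun Y _ => by rw [← mul_add]; exact mul_le_mul_of_nonneg_left (hY Y) (norm_nonneg _)
    _ = ∑ Y ∈ t.1, ‖τ Y‖ * ‖𝔇.𝒱 Z t ((s : ℝ) : ℂ) old₀ φ Y B‖ + (∑ Y ∈ t.1, ‖τ Y‖) * (S₀ * m * E₀ + S₀ * Cv * m * Rp) := by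
        rw [Finset.sum_add_distrib, Finset.sum_mul]
    _ ≤ (a₂₀ / 2 * (B ⬝ᵥ B) + w₀) + τs * (S₀ * m * E₀ + S₀ * Cv * m * Rp) :=
        add_le_add (h220₀ τ hτU B) (mul_le_mul_of_nonneg_right (hτ τ hτU) (by positivity))
    _ = a₂₀ / 2 * (B ⬝ᵥ B) + (w₀ + τs * (S₀ * m * (E₀ + Cv * Rp))) := by ring

end FromRecord220

omit [TopologicalSpace S] [OpensMeasurableSpace S] in
/-- ★★ **`h220W` AT THE TABLE-GERM SECTION FROM THE RECORD's (2.20) AT ONE ADMISSIBLE HISTORY** (§3 with `C_v := b⁻¹`). [folklore] -/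
theorem sum_norm_𝒱_tableGerms_le_of_record220 (hlaw : 𝔇.UnscaledFieldLawOn χu χcu 𝒲 𝒪 γ) (hread : 𝔇.ReadsBy 𝒪 R)
    (hmaps : ∀ Z t, (R Z t).MapsToTables sp (W Z t) univ) (hK : ∀ Z t, (R Z t).KernelBounded C) (hμ : ∀ Z t, (R Z t).FiniteMass m)
    (hC : 0 ≤ C) (hm : 0 ≤ m) (hκ : 0 ≤ κ) (hb : 0 < b) (hbw : ∀ j, b ≤ bw j) (hE₀ : 0 ≤ E₀) (hr₁ : 0 ≤ r₁)
    {Z : (domSys P M (k + 1)).Dom} {t : TermLabel P M k L} {s : ℝ} (hs : s ∈ Ioc (0 : ℝ) γ) {φ : CPair P 𝔸} (hφ : φ ∈ W Z t)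
    {old₀ : OlderTerms P 𝔸 M k} (hold₀ : old₀ ∈ AdmHist sp E₀ r₁ k)
    {Uτ : TDom P.d (L * domCount P M (k + 1)) → Set ℂ} {τs a₂₀ w₀ Rp : ℝ} (hRp : 0 ≤ Rp)
    (hτ : ∀ τ : TDom P.d (L * domCount P M (k + 1)) → ℂ, (∀ Y, τ Y ∈ Uτ Y) → ∑ Y ∈ t.1, ‖τ Y‖ ≤ τs)
    (h220₀ : ∀ τ : TDom P.d (L * domCount P M (k + 1)) → ℂ, (∀ Y, τ Y ∈ Uτ Y) → ∀ B : (𝔇.𝒦 Z t).Λ → ℝ,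
      ∑ Y ∈ t.1, ‖τ Y‖ * ‖𝔇.𝒱 Z t ((s : ℝ) : ℂ) old₀ φ Y B‖ ≤ a₂₀ / 2 * (B ⬝ᵥ B) + w₀)
    {p : Pot k sp} (hp : ‖p‖ ≤ Rp) (τ : TDom P.d (L * domCount P M (k + 1)) → ℂ) (hτU : ∀ Y, τ Y ∈ Uτ Y) (B : (𝔇.𝒦 Z t).Λ → ℝ) :
    ∑ Y ∈ t.1, ‖τ Y‖ * ‖𝔇.𝒱 Z t ((s : ℝ) : ℂ) (cv κ bw p) φ Y B‖ ≤
      a₂₀ / 2 * (B ⬝ᵥ B) + (w₀ + τs * ((∑ _j : Fin (k + 1), ∑ _X : (domSys P M _j).Dom, C) * m * (E₀ + b⁻¹ * Rp))) :=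
  sum_norm_𝒱_section_le_of_record220 𝔇 sp R W (cv (k := k) (sp := sp) κ bw) hlaw hread hmaps hK hμ hC hm (inv_pos.2 hb).le hE₀ hr₁
    (fun p j X ψ _ => norm_cv_le κ bw hκ hb hbw p j X ψ) (fun p j X => analyticOnNhd_cv κ bw p j X) hs hφ hold₀ hRp hτ h220₀ hp τ hτU B

/-! ## §2 The reading-side rows of N22's (AR) binder for this reading (module 105, re-exported) -/

/-- **(AR-adm) for the table-germ reading**: `‖ρ old‖ ≤ Bw·E₀` on `W1.AdmHist sp E₀ r₁ k` (`κ ≤ r₁`, `0 ≤ bw ≤ Bw`, open tables) — module 105 `norm_ρ_le_of_admHist`. [folklore] -/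
theorem norm_ρ_tableGerms_le (hsp : ∀ (j : ℕ) (Y : (domSys P M j).Dom), IsOpen (sp j Y)) (hκ : κ ≤ r₁) (hE₀ : 0 ≤ E₀)
    (hbw0 : ∀ j, 0 ≤ bw j) (hbw : ∀ j, bw j ≤ Bw) (hBw : 0 ≤ Bw) {old : OlderTerms P 𝔸 M k} (hold : old ∈ AdmHist sp E₀ r₁ k) :
    ‖ρ sp κ bw old‖ ≤ Bw * E₀ :=
  B13OlderTermsTableGerms.norm_ρ_le_of_admHist κ bw hsp hκ hE₀ hbw0 hbw hBw hold

/-- **(AR-dom₁) for the table-germ reading, in the Summit-side index form** (levels `k′ + 1`, `k′ < k`; no level-`0` table) — module 105 `norm_ρ_sub_ρ_le_succ`. [folklore] -/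
theorem norm_ρ_tableGerms_sub_le (hsp : ∀ (j : ℕ) (Y : (domSys P M j).Dom), IsOpen (sp j Y)) (hsp0 : ∀ (Y : (domSys P M 0).Dom), sp 0 Y = ∅)
    (hκ : κ ≤ r₁) (hE₀ : 0 ≤ E₀) (hbw0 : ∀ j, 0 ≤ bw j) (hbw : ∀ j, bw j ≤ Bw) {o o' : OlderTerms P 𝔸 M k}
    (ho : o ∈ AdmHist sp E₀ r₁ k) (ho' : o' ∈ AdmHist sp E₀ r₁ k) {B' : ℝ} (hB' : 0 ≤ B')
    (h : ∀ (k' : ℕ) (hk' : k' < k) (Y : (domSys P M (k' + 1)).Dom), ∀ ψ ∈ sp (k' + 1) Y,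
      bw ⟨k' + 1, Nat.succ_lt_succ hk'⟩ *
        (Real.exp (κ * (domSys P M (k' + 1)).dj Y) * ‖o ⟨k' + 1, Nat.succ_lt_succ hk'⟩ Y ψ - o' ⟨k' + 1, Nat.succ_lt_succ hk'⟩ Y ψ‖) ≤ B') :
    ‖ρ sp κ bw o - ρ sp κ bw o'‖ ≤ B' :=
  B13OlderTermsTableGerms.norm_ρ_sub_ρ_le_succ κ bw hsp hsp0 hκ hE₀ hbw0 hbw ho ho' hB' h

/-- **(AR-dom₂) for the table-germ reading, in the Summit-side index form** — module 105 `norm_ρ_threePoint_le_succ`. [folklore] -/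
theorem norm_ρ_tableGerms_threePoint_le (hsp : ∀ (j : ℕ) (Y : (domSys P M j).Dom), IsOpen (sp j Y))
    (hsp0 : ∀ (Y : (domSys P M 0).Dom), sp 0 Y = ∅) (hκ : κ ≤ r₁) (hE₀ : 0 ≤ E₀) (hbw0 : ∀ j, 0 ≤ bw j) (hbw : ∀ j, bw j ≤ Bw)
    {o₁ o₂ o₃ : OlderTerms P 𝔸 M k} (h₁ : o₁ ∈ AdmHist sp E₀ r₁ k) (h₂ : o₂ ∈ AdmHist sp E₀ r₁ k) (h₃ : o₃ ∈ AdmHist sp E₀ r₁ k) {B' : ℝ} (hB' : 0 ≤ B')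
    (h : ∀ (k' : ℕ) (hk' : k' < k) (Y : (domSys P M (k' + 1)).Dom), ∀ ψ ∈ sp (k' + 1) Y,
      bw ⟨k' + 1, Nat.succ_lt_succ hk'⟩ *
        (Real.exp (κ * (domSys P M (k' + 1)).dj Y) *
          ‖o₁ ⟨k' + 1, Nat.succ_lt_succ hk'⟩ Y ψ - 2 * o₂ ⟨k' + 1, Nat.succ_lt_succ hk'⟩ Y ψ + o₃ ⟨k' + 1, Nat.succ_lt_succ hk'⟩ Y ψ‖) ≤ B') :
    ‖ρ sp κ bw o₁ - (2 : ℂ) • ρ sp κ bw o₂ + ρ sp κ bw o₃‖ ≤ B' :=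
  B13OlderTermsTableGerms.norm_ρ_threePoint_le_succ κ bw hsp hsp0 hκ hE₀ hbw0 hbw h₁ h₂ h₃ hB' h

end YMDAG.N10

end
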